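import Mathlib
import Literature.NumberTheory.Transcendental.ZagierDilogarithmConjecture
import Literature.NumberTheory.Transcendental.BlochWignerDilogarithm
import Literature.NumberTheory.Transcendental.BlochWignerDilogarithmProofs
import Literature.NumberTheory.Transcendental.PreBlochGroup
import Summits.KontsevichZagierPeriods.KontsevichZagierPeriods.Theorems.HyperbolicBlochZagierDilogarithmConjectureStubCyclotomicSectorTorsionIff
import Summits.KontsevichZagierPeriods.KontsevichZagierPeriods.Theorems.HyperbolicBlochZagierDilogarithmConjectureStubCyclotomicFolding
import Summits.KontsevichZagierPeriods.KontsevichZagierPeriods.Theorems.HyperbolicBlochZagierDilogarithmConjectureStubCyclotomicSpanning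
import Summits.KontsevichZagierPeriods.KontsevichZagierPeriods.Theorems.HyperbolicBlochZagierDilogarithmConjectureStubSaturation
import HarnessLib

/-!
# `ZagierDilogarithmConjecture` (stmt-KontsevichZagierPeriods-10550) — line `kummer-clausen-linearisation`
(reshape c5, "the cyclotomic tower and the abelian sector"), stub `stub_cyclotomicSectorExact_iff_milnor`

**The EXACT level-`N` cyclotomic sector of Zagier's conjecture is equivalent to Milnor's conjecture
for `N`, conditionally on Suslin's unique divisibility of the pre-Bloch group.** Let `ζ_N = e^{2πi/N}`,
`D` the Bloch–Wigner dilogarithm (`blochWignerDilog`) and `⟨dilogRelators⟩ ⊆ ℤ[ℂ]` the relator group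
of Zagier's dilogarithm conjecture (Neumann 1998, §2.1). Assume the named fact
`Suslin1991_preBloch_isUniquelyDivisible` (Dupont 2001, Thm. 8.16, after Suslin), which by the landed
`stub_saturation` makes `⟨dilogRelators⟩` saturated: `M • x ∈ ⟨dilogRelators⟩`, `M ≥ 1`, forces
`x ∈ ⟨dilogRelators⟩`. Then for every level `N ≥ 1` (composite included) the following are equivalent:

* (the EXACT level-`N` cyclotomic sector) every `ℤ`-relation `Σᵢ nᵢ D(uᵢ) = 0` among `N`-th roots of
  unity `uᵢ` of the open upper half plane has its formal combination explained on the nose: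
  `Σᵢ nᵢ [uᵢ] ∈ ⟨dilogRelators⟩` (membership, not just a positive multiple);
* (Milnor's conjecture for `N`, `ℤ`-form) the Clausen values `D(ζ_N^c)`, `(c, N) = 1`, `0 < c < N/2`,
  admit only the trivial `ℤ`-relation (Milnor 1982, Appendix).

This is the line's `crux|μ_N ⇔ Milnor_N` for every `N`, the exact (non-torsion) upgrade of the
unconditional torsion-form equivalence.

Proof. The TORSION form of the equivalence is landed unconditionally: `stub_cyclotomicSectorTorsion_iff`
with its folding hypothesis discharged by `stub_cyclotomicFolding stub_cyclotomicSpanning` gives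
`TorsionSector_N ↔ Milnor_N`, where `TorsionSector_N` concludes `∃ M ≥ 1, M • Σᵢ nᵢ [uᵢ] ∈ ⟨dilogRelators⟩`.
`⇒`: the exact sector implies the torsion sector with `M = 1` (`one_nsmul`), hence Milnor_N.
`⇐`: Milnor_N gives the torsion sector, i.e. `M • x ∈ ⟨dilogRelators⟩` for some `M ≥ 1`, and saturation
(`stub_saturation` under Suslin) upgrades this to `x ∈ ⟨dilogRelators⟩`.
Sorry-free; axioms ⊆ {propext, Classical.choice, Quot.sound}.

## References

* W. D. Neumann, *Hilbert's 3rd problem and invariants of 3-manifolds*, Geom. Topol. Monogr. 1 (1998),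
  §2.1 and the remark after Thm. 2.10. [Neumann1998]
* J. Milnor, *Hyperbolic geometry: the first 150 years*, Bull. AMS 6 (1982), Appendix. [Milnor1982]
* J. L. Dupont, *Scissors congruences, group homology and characteristic classes*, World Scientific
  (2001), Thm. 8.16. [Dupont2001]
-/

noncomputable section

open scoped BigOperators ComplexConjugate
open Literature.NumberTheory.Transcendental

namespace Summit.KontsevichZagierPeriods.HyperbolicBloch.ZagierDilogarithmCyclotomic

open Summit.KontsevichZagierPeriods.HyperbolicBloch.ZagierDilogarithm (stub_saturation)

/-- **Stub `stub_cyclotomicSectorExact_iff_milnor`: the EXACT level-`N` cyclotomic sector of the crux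
is equivalent to Milnor's conjecture for `N`, modulo Suslin.** Under Suslin's unique divisibility of
the pre-Bloch group (`Suslin1991_preBloch_isUniquelyDivisible`, giving saturation of `⟨dilogRelators⟩`
via `stub_saturation`): for every `N ≥ 1`, Zagier's conjecture restricted to `N`-th roots of unity of
`ℍ⁺` in EXACT form (every `ℤ`-relation among their `D`-values has its formal combination in
`⟨dilogRelators⟩`) holds if and only if the Clausen values `D(ζ_N^c)`, `(c, N) = 1`, `0 < c < N/2`,
are `ℤ`-linearly independent. `⇒`: exact ⇒ torsion form with `M = 1`, then the unconditional torsion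
equivalence `stub_cyclotomicSectorTorsion_iff (stub_cyclotomicFolding stub_cyclotomicSpanning)`.
`⇐`: Milnor ⇒ torsion form `M • x ∈ ⟨dilogRelators⟩` ⇒ `x ∈ ⟨dilogRelators⟩` by saturation.
[cite: Milnor1982, Appendix] -/
theorem stub_cyclotomicSectorExact_iff_milnor :
    Suslin1991_preBloch_isUniquelyDivisible →
    ∀ (N : ℕ) [NeZero N],
      (∀ (k : ℕ) (u : Fin k → ℂ) (n : Fin k → ℤ), (∀ i, u i ^ N = 1) → (∀ i, 0 < (u i).im) →
          ∑ i, (n i : ℝ) * blochWignerDilog (u i) = 0 →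
            (∑ i, n i • FreeAbelianGroup.of (u i)) ∈ AddSubgroup.closure dilogRelators) ↔
        (∀ m : ZMod N → ℤ, (∀ c, m c ≠ 0 → IsUnit c ∧ 0 < c.val ∧ 2 * c.val < N) →
          ∑ c : ZMod N, (m c : ℝ) *
              blochWignerDilog (Complex.exp (2 * Real.pi * Complex.I / N) ^ c.val) = 0 →
            ∀ c, m c = 0) := by
  intro hSuslin N _
  -- the unconditional torsion-form equivalence at level `N`
  have htor := stub_cyclotomicSectorTorsion_iff (stub_cyclotomicFolding stub_cyclotomicSpanning) N
  constructor
  · -- `⇒`: exact sector ⇒ torsion sector (`M = 1`) ⇒ Milnor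
    intro hexact
    refine htor.1 fun k u n hpow him hsum => ⟨1, one_pos, ?_⟩
    rw [one_nsmul]
    exact hexact k u n hpow him hsum
  · -- `⇐`: Milnor ⇒ torsion sector ⇒ saturation
    intro hMil k u n hpow him hsum
    obtain ⟨M, hMpos, hmem⟩ := htor.2 hMil k u n hpow him hsum
    exact stub_saturation hSuslin M hMpos _ hmem

end Summit.KontsevichZagierPeriods.HyperbolicBloch.ZagierDilogarithmCyclotomic

end
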